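import Mathlib
import HarnessLib
import Literature.Analysis.FluidPDE.SuitableWeak
import Literature.Analysis.FluidPDE.LocalTypeI
import Literature.Analysis.FluidPDE.ESSLocalHolderNoConcentration
import Summits.NavierStokesRegularity.NavierStokesRegularity.Theorems.RellichScarNoMildScarGauge

/-!
# No mild scar under Type I (route RellichScar, item `NoMildScar`): far field and strips of an apex profile with zero scar

Helper file for the proof of `Summit.NavierStokesRegularity.NavierStokesRegularity.Theses.RellichScar.NoMildScar`
(stmt-NavierStokesRegularity-11723).  The RIGIDITY half of the argument, for a suitable weak
solution `(w, π)` on the backward slab with `𝐈 < ∞` which vanishes weakly at the final time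
(`htop`: `|∫ ⟪w(s), φ⟫| ≤ ε` for a.e. `s ∈ (s₀, 0)`) and is essentially bounded in the far field /
on strips below the final time (both consequences of the apex bound `|w| ≤ C/(‖x‖ + √(−t))`).
It follows the tree's discharge of ESS 2003, Thm. 1.4 (`ESSLocalHolderNoConcentration`), with
the per-cylinder pressure gauge of `RellichScarNoMildScarGauge` replacing the global `L^{3/2}`
class of the pressure, and the harmonic Liouville theorem in `L⁴` replacing the one in `L³`:

* `apex_farField_representative` — the far-field representative `Uf` of `w` (Serrin's theory,
  `NSBoundedHigherRegularityBounds_holds`) and `curl Uf = 0` beyond `|x| = R₀ + 2` (ESS §3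
  (3.31)–(3.32): backward uniqueness across half-spaces, the tree's `farField_curl_eq_zero`);
* `apex_strip_velocity_ae_zero` — on a bounded strip the vorticity vanishes in the far field,
  hence everywhere (unique continuation, `Carleman.uniqueContinuation_uncurried_c12`), the slice
  is harmonic and in `L⁴`, hence zero.

References: Escauriaza–Seregin–Šverák 2003, §3 and Thms. 4.1, 5.1; Seregin 2014, §6.6 and Ch. 7;
Lemarié-Rieusset 2016, proof of Thm. 15.4, Step 2.
-/

noncomputable section

-- the summit and its single sub-problem share the name (CONVENTIONS §1), as in every Theorems file
set_option linter.dupNamespace false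

namespace Summit.NavierStokesRegularity.NavierStokesRegularity.Theorems.RellichScarNoMildScar

open MeasureTheory Set Function Metric Filter Topology TopologicalSpace
open scoped ENNReal NNReal InnerProductSpace RealInnerProductSpace Laplacian
open Literature.Analysis Literature.Analysis.FluidPDE

local notation "E³" => EuclideanSpace ℝ (Fin 3)

variable {w : ℝ → E³ → E³} {π : ℝ → E³ → ℝ} {H : ℝ → E³ → E³ →L[ℝ] E³}

/-! ### The far field -/

/-- **The far-field representative of an apex profile with weak zero scar, and the vanishing of
its vorticity** (ESS 2003, §3, (3.26)–(3.32); the tree's `blowup_farField_representative` with the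
per-cylinder pressure gauge).  If `(w, π)` is a suitable weak solution on the backward slab with
`𝐈 < ∞`, `|w| ≤ 1` a.e. on `]-2, 0[ × {|x| > R₀}`, and `w` vanishes weakly at the final time, then
on `]-1, 0[ × {|x| > R₀ + 1}` the field `w` has a jointly continuous representative `Uf` with
`curl Uf = 0` on `]-1, 0[ × {|x| > R₀ + 2}`. [cite: EscauriazaSereginSverak2003, §3 (3.26)–(3.32)] -/
theorem apex_farField_representative
    (hsw : IsSuitableWeakSolutionOn (slab E³ (Iio 0) isOpen_Iio) 1 0 w π)
    (hI : typeIBound (Iio (0 : ℝ) ×ˢ univ) w π H < ⊤)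
    (htop : ∀ φ : E³ → E³, ContDiff ℝ (⊤ : ℕ∞) φ → HasCompactSupport φ → ∀ ε : ℝ, 0 < ε →
      ∃ s₀ : ℝ, s₀ < 0 ∧ ∀ᵐ s ∂(volume.restrict (Ioo s₀ 0)), |∫ y, ⟪w s y, φ y⟫| ≤ ε)
    {R₀ : ℝ} (hR₀ : 0 < R₀)
    (hfar : ∀ᵐ z ∂(volume.restrict (Ioo (-2 : ℝ) 0 ×ˢ (closedBall (0 : E³) R₀)ᶜ)), ‖w z.1 z.2‖ ≤ 1) :
    ∃ Uf : ℝ → E³ → E³,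
      uncurry Uf =ᵐ[volume.restrict (Ioo (-1 : ℝ) 0 ×ˢ (closedBall (0 : E³) (R₀ + 1))ᶜ)] uncurry w ∧
      ContinuousOn (uncurry Uf) (Ioo (-1 : ℝ) 0 ×ˢ (closedBall (0 : E³) (R₀ + 1))ᶜ) ∧
      ∀ z ∈ Ioo (-1 : ℝ) 0 ×ˢ {x : E³ | R₀ + 1 + 1 < ‖x‖}, curl (Uf z.1) z.2 = 0 := by
  set I : ℝ≥0∞ := typeIBound (Iio (0 : ℝ) ×ˢ (univ : Set E³)) w π H with hIdef
  have hItop : I ≠ ⊤ := hI.ne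
  set S : Set E³ := (closedBall (0 : E³) (R₀ + 1))ᶜ with hS
  have hSo : IsOpen S := isClosed_closedBall.isOpen_compl
  -- the thickening condition
  have hSS' : ∀ x ∈ S, ball x (2 * (1 / 2 : ℝ)) ⊆ (closedBall (0 : E³) R₀)ᶜ := by
    intro x hx y hy
    rw [hS, mem_compl_iff, mem_closedBall, dist_zero_right, not_le] at hx
    rw [mem_compl_iff, mem_closedBall, dist_zero_right, not_le]
    rw [mem_ball, dist_eq_norm] at hy
    have : ‖x‖ ≤ ‖y‖ + ‖y - x‖ := by
      calc ‖x‖ = ‖y - (y - x)‖ := by rw [sub_sub_cancel]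
        _ ≤ ‖y‖ + ‖y - x‖ := norm_sub_le _ _
    linarith
  -- ## the representative, cylinder by cylinder in the local gauge
  set P : ℝ≥0 := (ENNReal.ofReal (2 * (1 / 2 : ℝ)) ^ 2 * I).toNNReal with hP
  have hPeq : ((P : ℝ≥0) : ℝ≥0∞) = ENNReal.ofReal (2 * (1 / 2 : ℝ)) ^ 2 * I :=
    ENNReal.coe_toNNReal (ENNReal.mul_ne_top (ENNReal.pow_ne_top ENNReal.ofReal_ne_top) hItop)
  have hloc : ∀ z ∈ Ioo (-1 : ℝ) 0 ×ˢ S, ∃ πz : ℝ → E³ → ℝ,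
      IsDistributionalNSSolutionOn
        (parabolicCylinderOpens (2 * (1 / 2 : ℝ)) (min (z.1 + (1 / 2 : ℝ) ^ 2) 0, z.2)) 1 0 w πz ∧
      (∀ᵐ q ∂(volume.restrict (parabolicCylinder (2 * (1 / 2 : ℝ)) (min (z.1 + (1 / 2 : ℝ) ^ 2) 0, z.2))),
        ‖w q.1 q.2‖ ≤ (1 : ℝ)) ∧
      ∫⁻ q in parabolicCylinder (2 * (1 / 2 : ℝ)) (min (z.1 + (1 / 2 : ℝ) ^ 2) 0, z.2),
        ‖πz q.1 q.2‖ₑ ^ (3 / 2 : ℝ) ≤ P := by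
    rintro ⟨t, x⟩ ⟨ht, hx⟩
    set z₀ : ℝ × E³ := (min (t + (1 / 2 : ℝ) ^ 2) 0, x) with hz₀
    have hz₀t : z₀.1 ≤ 0 := min_le_right _ _
    refine ⟨fun s y => π s y - ⨍ y' in ball z₀.2 (2 * (1 / 2 : ℝ)), π s y', ?_, ?_, ?_⟩
    · exact ((sub_ballMean_slab hsw z₀.2 (by norm_num : (0 : ℝ) < 2 * (1 / 2))).of_le
        (parabolicCylinderOpens_le_slab _ hz₀t)).distributional
    · -- the cylinder lies in the far region
      have hcyl : parabolicCylinder (2 * (1 / 2 : ℝ)) z₀ ⊆ Ioo (-2 : ℝ) 0 ×ˢ (closedBall (0 : E³) R₀)ᶜ := by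
        rintro ⟨s, y⟩ hq
        rw [mem_parabolicCylinder] at hq
        obtain ⟨⟨hs1, hs2⟩, hy⟩ := hq
        refine ⟨⟨?_, lt_of_lt_of_le hs2 hz₀t⟩, hSS' x hx (mem_ball.2 hy)⟩
        have h1 : -1 < min (t + (1 / 2 : ℝ) ^ 2) 0 := lt_min (by linarith [ht.1]) (by norm_num)
        have h2 : z₀.1 = min (t + (1 / 2 : ℝ) ^ 2) 0 := rfl
        rw [h2] at hs1
        nlinarith
      exact ae_restrict_of_ae_restrict_of_subset hcyl hfar
    · rw [hPeq]
      exact lintegral_sub_ballMean_le_typeIBound (by norm_num) hz₀t w π H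
  obtain ⟨K, U, hUw, hUc, hCD, hjc, hbdK⟩ := exists_smooth_representative_of_locally_bounded_gauge
    NSBoundedHigherRegularityBounds_holds hSo (by norm_num : (0 : ℝ) < 1 / 2) hloc 4
  refine ⟨U, hUw, hUc, ?_⟩
  -- ## the equations on the far region, and `curl U = 0` by backward uniqueness
  set Ω : Set (ℝ × E³) := Ioo (-1 : ℝ) 0 ×ˢ S with hΩ
  have hΩo : IsOpen Ω := isOpen_Ioo.prod hSo
  have hΩle : (⟨Ω, hΩo⟩ : Opens (ℝ × E³)) ≤ (slab E³ (Iio (0 : ℝ)) isOpen_Iio) := by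
    intro z hz
    rw [mem_slab]
    exact hz.1.2
  have hsolw : IsDistributionalNSSolutionOn ⟨Ω, hΩo⟩ 1 0 w π := (hsw.of_le hΩle).distributional
  have hsol : IsDistributionalNSSolutionOn ⟨Ω, hΩo⟩ 1 0 U π :=
    hsolw.congr_ae hUw.symm (ae_of_all _ fun _ => rfl)
  have hU4 : ∀ t ∈ Ioo (-1 : ℝ) 0, ContDiffOn ℝ 4 (U t) S := fun t ht x hx =>
    ((hCD (t, x) ⟨ht, hx⟩).of_le (by norm_cast)).contDiffWithinAt
  have hΦ : ∀ n ≤ 4, ContinuousOn (fun z : ℝ × E³ => iteratedFDeriv ℝ n (U z.1) z.2) Ω :=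
    fun n _ => hjc n
  have hK : ∀ n ≤ 3, ∀ z ∈ Ω, ‖iteratedFDeriv ℝ n (U z.1) z.2‖ ≤ K := fun n hn z hz => hbdK n (by omega) z hz
  exact farField_curl_eq_zero (by linarith : (0 : ℝ) ≤ R₀ + 1) htop hUw hsol hU4 hΦ hK

/-! ### The interior step: unique continuation and Liouville on a bounded strip -/

/-- **The interior step of ESS 2003, Thm. 1.4, for an apex profile** (§3, after (3.32); Seregin
2014, Ch. 7 p. 139; the tree's `strip_velocity_ae_zero` with the per-cylinder gauge and the `L⁴`
Liouville theorem).  Let `(w, π)` be a suitable weak solution on the backward slab with `𝐈 < ∞` and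
the apex bound a.e., let `Uf` be its far-field representative on `]-1, 0[ × {|x| > R₁}` with
`curl Uf = 0` for `|x| > R₁ + 1`, and let `]a, b[ × ℝ³`, `b ≤ 0`, be a strip with `|w| ≤ L` a.e. on
`]a - 4ρ², b[ × ℝ³`. Then `w(s, ·) = 0` a.e. for a.e. `s ∈ ]a, b[`: the smooth representative on the
strip has vorticity of class `C¹₂` with the Carleman inequality, vanishing in the far field, hence
identically by unique continuation across the sphere; the slice is harmonic and, for a.e. `t`, in
`L⁴(ℝ³)` by the apex bound, so it vanishes. [cite: EscauriazaSereginSverak2003, §3 after (3.32) and Thm. 4.1] -/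
theorem apex_strip_velocity_ae_zero
    (hsw : IsSuitableWeakSolutionOn (slab E³ (Iio 0) isOpen_Iio) 1 0 w π)
    (hwg : HasWeakSpatialGradientOn (slab E³ (Iio 0) isOpen_Iio) w H)
    (hI : typeIBound (Iio (0 : ℝ) ×ˢ univ) w π H < ⊤) {C : ℝ}
    (hapex : ∀ᵐ z ∂(volume.restrict (Iio (0 : ℝ) ×ˢ (univ : Set E³))),
      ‖w z.1 z.2‖ ≤ C / (‖z.2‖ + Real.sqrt (-z.1)))
    {R₁ : ℝ} (hR₁ : 0 < R₁) {Uf : ℝ → E³ → E³}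
    (hUf : uncurry Uf =ᵐ[volume.restrict (Ioo (-1 : ℝ) 0 ×ˢ (closedBall (0 : E³) R₁)ᶜ)] uncurry w)
    (hUfc : ContinuousOn (uncurry Uf) (Ioo (-1 : ℝ) 0 ×ˢ (closedBall (0 : E³) R₁)ᶜ))
    (hcurl : ∀ z ∈ Ioo (-1 : ℝ) 0 ×ˢ {x : E³ | R₁ + 1 < ‖x‖}, curl (Uf z.1) z.2 = 0)
    {a b ρ L : ℝ} (hρ : 0 < ρ) (ha : -1 ≤ a - 4 * ρ ^ 2) (hb : b ≤ 0)
    (hbd : ∀ᵐ z ∂(volume.restrict (Ioo (a - 4 * ρ ^ 2) b ×ˢ (univ : Set E³))), ‖w z.1 z.2‖ ≤ L) :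
    ∀ᵐ s ∂(volume.restrict (Ioo a b)), w s =ᵐ[volume] 0 := by
  set I₀ : ℝ≥0∞ := typeIBound (Iio (0 : ℝ) ×ˢ (univ : Set E³)) w π H with hI₀def
  have hI₀top : I₀ ≠ ⊤ := hI.ne
  -- ### the representative on the strip
  set I : Set ℝ := Ioo a b with hIdef
  have hIo : IsOpen I := isOpen_Ioo
  set Ω : Set (ℝ × E³) := I ×ˢ (univ : Set E³) with hΩdef
  have hΩo : IsOpen Ω := hIo.prod isOpen_univ
  have hIsub : I ⊆ Ioo (-1 : ℝ) 0 := Ioo_subset_Ioo (by nlinarith [sq_nonneg ρ]) hb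
  set P : ℝ≥0 := (ENNReal.ofReal (2 * ρ) ^ 2 * I₀).toNNReal with hP
  have hPeq : ((P : ℝ≥0) : ℝ≥0∞) = ENNReal.ofReal (2 * ρ) ^ 2 * I₀ :=
    ENNReal.coe_toNNReal (ENNReal.mul_ne_top (ENNReal.pow_ne_top ENNReal.ofReal_ne_top) hI₀top)
  have hloc : ∀ z ∈ Ioo a b ×ˢ (univ : Set E³), ∃ πz : ℝ → E³ → ℝ,
      IsDistributionalNSSolutionOn
        (parabolicCylinderOpens (2 * ρ) (min (z.1 + ρ ^ 2) b, z.2)) 1 0 w πz ∧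
      (∀ᵐ q ∂(volume.restrict (parabolicCylinder (2 * ρ) (min (z.1 + ρ ^ 2) b, z.2))),
        ‖w q.1 q.2‖ ≤ L) ∧
      ∫⁻ q in parabolicCylinder (2 * ρ) (min (z.1 + ρ ^ 2) b, z.2), ‖πz q.1 q.2‖ₑ ^ (3 / 2 : ℝ) ≤ P := by
    rintro ⟨t, x⟩ ⟨ht, -⟩
    set z₀ : ℝ × E³ := (min (t + ρ ^ 2) b, x) with hz₀
    have hz₀t : z₀.1 ≤ 0 := (min_le_right _ _).trans hb
    refine ⟨fun s y => π s y - ⨍ y' in ball z₀.2 (2 * ρ), π s y', ?_, ?_, ?_⟩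
    · exact ((sub_ballMean_slab hsw z₀.2 (by positivity : (0 : ℝ) < 2 * ρ)).of_le
        (parabolicCylinderOpens_le_slab _ hz₀t)).distributional
    · have hcyl : parabolicCylinder (2 * ρ) z₀ ⊆ Ioo (a - 4 * ρ ^ 2) b ×ˢ (univ : Set E³) := by
        rintro ⟨s, y⟩ hq
        rw [mem_parabolicCylinder] at hq
        obtain ⟨⟨hs1, hs2⟩, -⟩ := hq
        refine ⟨⟨?_, lt_of_lt_of_le hs2 (min_le_right _ _)⟩, mem_univ _⟩
        have h1 : a < min (t + ρ ^ 2) b := lt_min (by linarith [ht.1, sq_nonneg ρ]) (ht.1.trans ht.2)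
        have h2 : z₀.1 = min (t + ρ ^ 2) b := rfl
        rw [h2] at hs1
        nlinarith
      exact ae_restrict_of_ae_restrict_of_subset hcyl hbd
    · rw [hPeq]
      exact lintegral_sub_ballMean_le_typeIBound (by positivity) hz₀t w π H
  obtain ⟨K, U, hUw, hUc, hCD, hjc, hbdK⟩ := exists_smooth_representative_of_locally_bounded_gauge
    NSBoundedHigherRegularityBounds_holds isOpen_univ hρ hloc 4
  -- the equations hold for the representative
  have hΩle : (⟨Ω, hΩo⟩ : Opens (ℝ × E³)) ≤ (slab E³ (Iio (0 : ℝ)) isOpen_Iio) := by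
    intro z hz
    rw [mem_slab]
    exact (hIsub hz.1).2
  have hsolw : IsDistributionalNSSolutionOn ⟨Ω, hΩo⟩ 1 0 w π := (hsw.of_le hΩle).distributional
  have hsol : IsDistributionalNSSolutionOn ⟨Ω, hΩo⟩ 1 0 U π :=
    hsolw.congr_ae hUw.symm (ae_of_all _ fun _ => rfl)
  have hU4 : ∀ t ∈ I, ContDiffOn ℝ 4 (U t) (univ : Set E³) := fun t ht x _ =>
    ((hCD (t, x) ⟨ht, mem_univ _⟩).of_le (by norm_cast)).contDiffWithinAt
  have hΦ : ∀ n ≤ 4, ContinuousOn (fun z : ℝ × E³ => iteratedFDeriv ℝ n (U z.1) z.2) Ω := fun n _ => hjc n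
  have hK₀ : ∀ z ∈ Ω, ‖U z.1 z.2‖ ≤ K := fun z hz => by
    have h := hbdK 0 (by norm_num) z hz
    rwa [norm_iteratedFDeriv_zero] at h
  have hK₁ : ∀ z ∈ Ω, ‖fderiv ℝ (U z.1) z.2‖ ≤ K := fun z hz => by
    have h := hbdK 1 (by norm_num) z hz
    rwa [norm_iteratedFDeriv_one] at h
  -- ### the vorticity: class `C¹₂`, equation, far-field vanishing
  obtain ⟨hdiv, -, -, hω1, hωx⟩ := vorticity_c12_of_isDistributionalNSSolutionOn hIo isOpen_univ hsol hU4 hΦ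
  obtain ⟨-, -, hineq⟩ := vorticity_carleman_inequality hIo isOpen_univ hsol hU4 hΦ hK₀ hK₁
  have hωbd : ∀ z ∈ Ω, ‖(uncurry (vorticity U)) z‖ ≤ ‖curlCLM‖ * K := fun z hz => by
    show ‖vorticity U z.1 z.2‖ ≤ _
    rw [vorticity_apply]
    exact (norm_curl_le _ _).trans (mul_le_mul_of_nonneg_left (hK₁ z hz) (ContinuousLinearMap.opNorm_nonneg curlCLM))
  have hfarΩ : ∀ z ∈ I ×ˢ {x : E³ | R₁ + 1 < ‖x‖}, vorticity U z.1 z.2 = 0 := by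
    set O : Set (ℝ × E³) := I ×ˢ (closedBall (0 : E³) R₁)ᶜ with hO
    have hOo : IsOpen O := hIo.prod isClosed_closedBall.isOpen_compl
    have hOΩ : O ⊆ Ω := prod_mono Subset.rfl (subset_univ _)
    have hOF : O ⊆ Ioo (-1 : ℝ) 0 ×ˢ (closedBall (0 : E³) R₁)ᶜ := prod_mono hIsub Subset.rfl
    have hae1 : uncurry U =ᵐ[volume.restrict O] uncurry w := ae_restrict_of_ae_restrict_of_subset hOΩ hUw
    have hae2 : uncurry Uf =ᵐ[volume.restrict O] uncurry w := ae_restrict_of_ae_restrict_of_subset hOF hUf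
    have hae : uncurry U =ᵐ[volume.restrict O] uncurry Uf := hae1.trans hae2.symm
    have heqOn : EqOn (uncurry U) (uncurry Uf) O :=
      Measure.eqOn_open_of_ae_eq hae hOo (hUc.mono hOΩ) (hUfc.mono hOF)
    rintro ⟨t, x⟩ ⟨ht, hx⟩
    have hx' : R₁ + 1 < ‖x‖ := hx
    have hxc : x ∈ (closedBall (0 : E³) R₁)ᶜ := by
      rw [mem_compl_iff, mem_closedBall, dist_zero_right, not_le]; linarith
    have hev : U t =ᶠ[𝓝 x] Uf t := slice_eventuallyEq hOo heqOn (w := (t, x)) ⟨ht, hxc⟩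
    show vorticity U t x = 0
    rw [vorticity_apply, curl_eq_curlCLM, hev.fderiv_eq, ← curl_eq_curlCLM]
    exact hcurl (t, x) ⟨hIsub ht, hx'⟩
  -- ### unique continuation across the sphere `|x| = R₁ + 1`, at every time of the strip
  have hωzero : ∀ t ∈ I, ∀ x : E³, vorticity U t x = 0 := by
    intro t ht x
    by_cases hxfar : R₁ + 1 < ‖x‖
    · exact hfarΩ (t, x) ⟨ht, hxfar⟩
    push Not at hxfar
    have hK0 : 0 ≤ K := (norm_nonneg _).trans (hK₀ (t, 0) ⟨ht, mem_univ _⟩)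
    set e₀ : E³ := EuclideanSpace.basisFun (Fin 3) ℝ 0 with he₀
    have he₀n : ‖e₀‖ = 1 := (EuclideanSpace.basisFun (Fin 3) ℝ).orthonormal.1 0
    set x₁ : E³ := (R₁ + 3) • e₀ with hx₁
    have hx₁n : ‖x₁‖ = R₁ + 3 := by
      rw [hx₁, norm_smul, he₀n, mul_one, Real.norm_eq_abs, abs_of_pos (by linarith)]
    set Rb : ℝ := 2 * R₁ + 10 with hRb
    have hRbpos : 0 < Rb := by positivity
    set T' : ℝ := t - a with hT'
    have hT'pos : 0 < T' := by have := ht.1; simp only [hT']; linarith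
    set A : ℝ × E³ → ℝ × E³ := stAffine (-1) 1 t x₁ with hAdef
    have hA1 : ∀ z : ℝ × E³, (A z).1 = t - z.1 := fun z => by
      show t + (-1) * z.1 = t - z.1; ring
    have hA2 : ∀ z : ℝ × E³, (A z).2 = x₁ + z.2 := fun z => by
      show x₁ + (1 : ℝ) • z.2 = x₁ + z.2; rw [one_smul]
    set Q' : Set (ℝ × E³) := Ioo (0 : ℝ) T' ×ˢ ball (0 : E³) Rb with hQ'
    have hAΩ' : ∀ z ∈ Ico (0 : ℝ) T' ×ˢ ball (0 : E³) Rb, A z ∈ Ω := by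
      rintro ⟨s, y⟩ ⟨hs, -⟩
      refine ⟨?_, mem_univ _⟩
      rw [hA1]
      have h1 := hs.1
      have h2 := hs.2
      simp only [hT'] at h2
      exact ⟨by simp only; linarith, by simp only; linarith [ht.2]⟩
    have hAΩ : ∀ z ∈ Q', A z ∈ Ω := fun z hz => hAΩ' z ⟨Ioo_subset_Ico_self hz.1, hz.2⟩
    set ω : ℝ × E³ → E³ := uncurry (vorticity U) with hωdef
    set uu : ℝ × E³ → E³ := fun z => ω (A z) with hudef
    have hu1 : ContDiffOn ℝ 1 uu Q' :=
      (Carleman.contDiffOn_comp_stAffine hω1 (-1) 1 t x₁).mono fun z hz => hAΩ z hz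
    have hdxu : ∀ e : E³, Carleman.dx e uu = fun z => Carleman.dx e ω (A z) := by
      intro e
      funext z
      rw [hudef, Carleman.dx_comp_stAffine (by norm_num) one_ne_zero ω e z, one_smul]
    have hux : ∀ e : E³, ContDiffOn ℝ 1 (Carleman.dx e uu) Q' := by
      intro e
      rw [hdxu e]
      exact (Carleman.contDiffOn_comp_stAffine (hωx e) (-1) 1 t x₁).mono fun z hz => hAΩ z hz
    have hucont : ContinuousOn uu (Ico (0 : ℝ) T' ×ˢ ball (0 : E³) Rb) :=
      (Carleman.continuousOn_comp_stAffine hω1.continuousOn (-1) 1 t x₁).mono fun z hz => hAΩ' z hz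
    have hdtu : ∀ z, Carleman.dt uu z = (-1 : ℝ) • Carleman.dt ω (A z) := fun z => by
      rw [hudef, Carleman.dt_comp_stAffine (by norm_num) one_ne_zero]
    have hlapu : ∀ z, Carleman.lap uu z = Carleman.lap ω (A z) := fun z => by
      rw [hudef, Carleman.lap_comp_stAffine (by norm_num) one_ne_zero, one_pow, one_smul]
    have hgradu : ∀ z, Carleman.gradSq uu z = Carleman.gradSq ω (A z) := fun z => by
      rw [hudef, Carleman.gradSq_comp_stAffine (by norm_num) one_ne_zero, one_pow, one_mul]
    have hinequ : ∀ z ∈ Q', ‖Carleman.dt uu z + Carleman.lap uu z‖ ≤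
        (K + K) * (‖uu z‖ + Real.sqrt (Carleman.gradSq uu z)) := by
      intro z hz
      rw [hdtu z, hlapu z, hgradu z]
      have e1 : (-1 : ℝ) • Carleman.dt ω (A z) + Carleman.lap ω (A z) =
          -(Carleman.dt ω (A z) - Carleman.lap ω (A z)) := by
        rw [neg_one_smul]; abel
      rw [e1, norm_neg]
      exact hineq (A z) (hAΩ z hz)
    have hvan : ∀ k : ℕ, ∃ C₀ : ℝ, ∀ z ∈ Q', ‖uu z‖ ≤ C₀ * (‖z.2‖ + Real.sqrt z.1) ^ k := by
      intro k
      refine ⟨‖curlCLM‖ * K, fun z hz => ?_⟩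
      have hbase : 0 ≤ ‖z.2‖ + Real.sqrt z.1 := by positivity
      by_cases hy : ‖z.2‖ < 2
      · have hfar' : R₁ + 1 < ‖x₁ + z.2‖ := by
          have h := norm_sub_le (x₁ + z.2) z.2
          rw [add_sub_cancel_right, hx₁n] at h
          linarith
        have h0 : uu z = 0 := by
          have h := hfarΩ (A z) ⟨(hAΩ z hz).1, by rw [hA2]; exact hfar'⟩
          show ω (A z) = 0
          exact h
        rw [h0, norm_zero]
        positivity
      · push Not at hy
        have h1 : (1 : ℝ) ≤ (‖z.2‖ + Real.sqrt z.1) ^ k :=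
          one_le_pow₀ (by linarith [Real.sqrt_nonneg z.1])
        calc ‖uu z‖ = ‖ω (A z)‖ := rfl
          _ ≤ ‖curlCLM‖ * K := hωbd _ (hAΩ z hz)
          _ = ‖curlCLM‖ * K * 1 := (mul_one _).symm
          _ ≤ ‖curlCLM‖ * K * (‖z.2‖ + Real.sqrt z.1) ^ k :=
              mul_le_mul_of_nonneg_left h1 (by positivity)
    have huc := Carleman.uniqueContinuation_uncurried_c12 3 3 (c₁ := K + K) (R := Rb) (T := T')
      (by positivity) hRbpos hT'pos hu1 hux hucont hinequ hvan
    have hy : x - x₁ ∈ ball (0 : E³) Rb := by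
      rw [mem_ball_zero_iff]
      calc ‖x - x₁‖ ≤ ‖x‖ + ‖x₁‖ := norm_sub_le _ _
        _ < Rb := by rw [hx₁n, hRb]; linarith
    have h := huc (x - x₁) hy
    have hA0 : A (0, x - x₁) = (t, x) := by
      show (t + (-1) * (0 : ℝ), x₁ + (1 : ℝ) • (x - x₁)) = (t, x)
      simp
    have h' : ω (A (0, x - x₁)) = 0 := h
    rw [hA0] at h'
    exact h'
  -- ### the velocity slices are harmonic
  have hharm : ∀ t ∈ I, InnerProductSpace.HarmonicOnNhd (U t) (univ : Set E³) := by
    intro t ht x _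
    have hcd : ContDiff ℝ 2 (U t) := contDiff_iff_contDiffAt.2 fun y =>
      (hCD (t, y) ⟨ht, mem_univ _⟩).of_le (by norm_cast)
    have hΔ : ∀ y, Δ (U t) y = 0 :=
      laplacian_eq_zero_of_curl_eq_zero_of_isDivFree hcd
        (fun y => by rw [← vorticity_apply]; exact hωzero t ht y)
        (fun y => hdiv (t, y) ⟨ht, mem_univ _⟩)
    show InnerProductSpace.HarmonicAt (U t) x
    constructor
    · exact hcd.contDiffAt
    · exact Filter.Eventually.of_forall fun y => by rw [Pi.zero_apply]; exact hΔ y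
  -- ### a.e. slice: `U(t) = w(t)` a.e. and `w(t) ∈ L⁴`, so `U(t) = 0`
  have hwm : AEStronglyMeasurable (uncurry w) (volume.restrict (Iio (0 : ℝ) ×ˢ (univ : Set E³))) := by
    have h := hwg.locallyIntegrableOn.aestronglyMeasurable
    rwa [coe_slab] at h
  have hslice : ∀ᵐ t ∂(volume.restrict I), U t =ᵐ[volume] w t := by
    have h1 : ∀ᵐ z ∂((volume.restrict I).prod (volume : Measure E³)), uncurry U z = uncurry w z := by
      rw [Measure.restrict_prod_eq_prod_univ, ← Measure.volume_eq_prod]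
      exact hUw
    filter_upwards [Measure.ae_ae_of_ae_prod h1] with t ht
    filter_upwards [ht] with x hx
    exact hx
  have hL4 : ∀ᵐ t ∂(volume.restrict I), MemLp (w t) 4 volume := by
    have hprod : (volume.restrict (Iio (0 : ℝ) ×ˢ (univ : Set E³)) : Measure (ℝ × E³)) =
        (volume.restrict (Iio (0 : ℝ))).prod (volume : Measure E³) := by
      rw [Measure.restrict_prod_eq_prod_univ, ← Measure.volume_eq_prod]
    rw [hprod] at hwm hapex
    have h1 := Measure.ae_ae_of_ae_prod hapex
    have h2 := hwm.prodMk_left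
    refine ae_restrict_of_ae_restrict_of_subset (hIsub.trans Ioo_subset_Iio_self) ?_
    filter_upwards [h1, h2, ae_restrict_mem measurableSet_Iio] with t ht hmt htneg
    have htneg' : t < 0 := htneg
    exact memLp_four_of_apex_bound hmt (Real.sqrt_pos.2 (by linarith)) ht
  filter_upwards [ae_restrict_mem measurableSet_Ioo, hslice, hL4] with t ht hUt hL4t
  have hmemU : MemLp (U t) 4 volume := hL4t.ae_eq hUt.symm
  have hU0 : U t = 0 :=
    eq_zero_of_harmonic_memLp_inner (hharm t ht) (q := 4) (by norm_num) (by norm_num) hmemU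
  filter_upwards [hUt] with x hx
  rw [← hx, hU0]

end Summit.NavierStokesRegularity.NavierStokesRegularity.Theorems.RellichScarNoMildScar

end
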